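import Mathlib
import Summits.KontsevichZagierPeriods.Zeta5Search.LaiDecayStirling
import Summits.KontsevichZagierPeriods.Zeta5Search.WellPoisedFaceBoundaryRate
import HarnessLib

/-!
# ζ(5) search — UNIFORM STIRLING for Lai's box summand: `|log(C_n R_n(ν)) − n f(ν/n)| ≤ C log(ν+(M+r)n+2)`
# (fam-indep, κ₃ ladder, gen 5; decay target D1, part 2 of 2)

HONEST FRAMING: systematic search; no irrationality claim unless certified.

OUR work (Summit side; cell `pub-zeta5`, family `indep`, planner seat gen 5, STAGED for the lane). Second half of target
(D1) of `LaiDecaySplit` = families/indep/DECAY-L1.md Lemma 2.1. From `LaiDecayStirling.log_laiTermR_laiC` (the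
summand's logarithm as a signed sum of `log m!`) and the tree's Stirling error term `WellPoisedFaceRate.logFactErr`
(`log m! = m log m − m + E(m)`, `0 ≤ E(m) ≤ log m/2 + 1`):

* `laiMain J r M n δ ν` — the main part `Σ ± m log m` (the linear terms cancel EXACTLY: the series is balanced);
  `log_laiTermR_laiC_eq_main_add` — `log(C_n R_n(ν)) = laiMain + (four explicit logs) + (signed Stirling errors)`;
* **`laiMain_eq`** — `laiMain = n · laiProfile J r M δ (ν/n)` (homogeneity of `y log y`; this is where the profile
  of `LaiDecaySplit` comes from);
* **`abs_log_laiTermR_sub_le`** — `|log(C_n R_n(ν)) − n f(ν/n)| ≤ laiStirC J r · log(ν + (M+r)n + 2)` for `ν > rn`,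
  `n ≥ 1`, `2δ_j < M`, with the explicit constant `laiStirC J r = 10 + 6J + 6r`;
* **`laiTermR_laiC_upper` / `laiTermR_laiC_lower`** — EXACTLY the `upper` / `lower` fields of
  `LaiDecayInputs J r M δ (laiC J r M · δ)` with `C := laiStirC J r`; and `laiTermR_laiC_summable` — the `summable`
  field, from the tree's `laiBox_hasSum_oddZeta` (p237299) under its hypotheses.

With `LaiDecayStirling` (nonneg / zero), `LaiDecayMax` (isMax) and this file, the only input of `LaiDecayInputs` at a
ladder point not yet discharged is the TAIL (D3). MANUSCRIPT-LEVEL CANDIDATE context only ('κ₃ ≤ 73'): no margin or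
dimension statement; no `LaiDecayInputs` instance is built here.

References: [Lai2024BallRivoal] L. Lai, arXiv:2407.14236, §13 and p. 48; families/indep/DECAY-L1.md §2 Lemma 2.1;
Stirling with explicit error [folklore] (tree `WellPoisedFaceRate.logFactErr_bounds`).
-/

open Finset
open scoped Nat

namespace Summit.KontsevichZagierPeriods.Zeta5Search

open WellPoisedFaceRate (logFactErr log_factorial_eq logFactErr_bounds)

noncomputable section

variable {J r M n : ℕ} {δ : Fin J → ℕ} {ν : ℕ}

/-! ### The main part and the exact decomposition -/

/-- The MAIN PART `Σ ± m log m` of `log(C_n R_n(ν))` (arguments kept as natural numbers). [this file] -/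
def laiMain (J r M n : ℕ) (δ : Fin J → ℕ) (ν : ℕ) : ℝ :=
  (∑ j : Fin J, xlnx ((((M - 2 * δ j) * n : ℕ)) : ℝ)) - 2 * r * xlnx (n : ℝ) + xlnx (ν : ℝ) -
    xlnx (((ν - r * n : ℕ)) : ℝ) + xlnx (((ν + M * n + r * n : ℕ)) : ℝ) - xlnx (((ν + M * n : ℕ)) : ℝ) -
    ∑ j : Fin J, (xlnx (((ν + δ j * n + (M - 2 * δ j) * n : ℕ)) : ℝ) - xlnx (((ν + δ j * n : ℕ)) : ℝ))

/-- The four explicit logarithms left over by the index shifts `ν−1 ↦ ν`, `ν+δ_jn−1 ↦ ν+δ_jn`. [this file] -/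
def laiErrLog (J r M n : ℕ) (δ : Fin J → ℕ) (ν : ℕ) : ℝ :=
  Real.log (2 * (ν : ℝ) + (M : ℝ) * n) - Real.log (ν : ℝ) + Real.log (((ν - r * n : ℕ)) : ℝ) -
    ∑ j : Fin J, Real.log (((ν + δ j * n : ℕ)) : ℝ)

/-- The signed sum of Stirling errors `E(m) = log m! − (m log m − m)`. [this file] -/
def laiErrStirling (J r M n : ℕ) (δ : Fin J → ℕ) (ν : ℕ) : ℝ :=
  logFactErr ν - logFactErr (ν - r * n) + logFactErr (ν + M * n + r * n) - logFactErr (ν + M * n) -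
    (∑ j : Fin J, (logFactErr (ν + δ j * n + (M - 2 * δ j) * n) - logFactErr (ν + δ j * n))) +
    (∑ j : Fin J, logFactErr ((M - 2 * δ j) * n)) - 2 * r * logFactErr n

/-- `log (m−1)! = log m! − log m` for `m ≥ 1`. [folklore] -/
theorem log_factorial_pred {m : ℕ} (hm : 1 ≤ m) :
    Real.log (((m - 1)! : ℕ) : ℝ) = Real.log ((m ! : ℕ) : ℝ) - Real.log (m : ℝ) := by
  obtain ⟨k, rfl⟩ : ∃ k, m = k + 1 := ⟨m - 1, by omega⟩
  simp only [Nat.add_sub_cancel, Nat.factorial_succ, Nat.cast_mul]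
  rw [Real.log_mul (by positivity) (by positivity)]
  push_cast; ring

/-- **Exact decomposition**: `log(C_n R_n(ν)) = laiMain + laiErrLog + laiErrStirling` (`ν > rn`): Stirling inserted,
the linear terms cancel. [this file] -/
theorem log_laiTermR_laiC_eq_main_add (hν : r * n < ν) :
    Real.log (laiTermR J r M n δ (fun m => laiC J r M m δ) ν) =
      laiMain J r M n δ ν + laiErrLog J r M n δ ν + laiErrStirling J r M n δ ν := by
  rw [log_laiTermR_laiC J r M n δ hν]
  have s1 : Real.log (((ν - 1)! : ℕ) : ℝ) = Real.log ((ν ! : ℕ) : ℝ) - Real.log (ν : ℝ) :=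
    log_factorial_pred (by omega)
  have s2 : Real.log (((ν - 1 - r * n)! : ℕ) : ℝ) =
      Real.log (((ν - r * n)! : ℕ) : ℝ) - Real.log (((ν - r * n : ℕ)) : ℝ) := by
    rw [show ν - 1 - r * n = (ν - r * n) - 1 by omega]; exact log_factorial_pred (by omega)
  have s3 : ∀ j : Fin J, Real.log (((ν + δ j * n - 1)! : ℕ) : ℝ) =
      Real.log (((ν + δ j * n)! : ℕ) : ℝ) - Real.log (((ν + δ j * n : ℕ)) : ℝ) := fun j =>
    log_factorial_pred (by omega)
  have s3' : ∑ j : Fin J, (Real.log (((ν + δ j * n + (M - 2 * δ j) * n)! : ℕ) : ℝ) -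
        Real.log (((ν + δ j * n - 1)! : ℕ) : ℝ)) =
      ∑ j : Fin J, (Real.log (((ν + δ j * n + (M - 2 * δ j) * n)! : ℕ) : ℝ) -
        (Real.log (((ν + δ j * n)! : ℕ) : ℝ) - Real.log (((ν + δ j * n : ℕ)) : ℝ))) :=
    sum_congr rfl fun j _ => by rw [s3 j]
  rw [s1, s2, s3']
  simp only [log_factorial_eq]
  unfold laiMain laiErrLog laiErrStirling xlnx
  have hc1 : (((ν - r * n : ℕ)) : ℝ) = (ν : ℝ) - r * n := by rw [Nat.cast_sub hν.le]; push_cast; ring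
  rw [hc1]
  push_cast
  simp only [sum_sub_distrib, sum_add_distrib]
  ring

/-! ### The main part is `n · f(ν/n)` -/

/-- **Homogeneity**: `laiMain = n · laiProfile J r M δ (ν/n)` (`n ≥ 1`, `ν > rn`, `2δ_j < M`). [this file] -/
theorem laiMain_eq (hδ : ∀ j, 2 * δ j < M) (hn : 1 ≤ n) (hν : r * n < ν) :
    laiMain J r M n δ ν = n * laiProfile J r M δ ((ν : ℝ) / n) := by
  have hn0 : (0 : ℝ) < n := by exact_mod_cast hn
  have hν0 : (0 : ℝ) < ν := by exact_mod_cast (show 0 < ν by omega)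
  have hrn : (r : ℝ) * n < ν := by exact_mod_cast hν
  have hδ' : ∀ j, 2 * (δ j : ℝ) < M := fun j => by exact_mod_cast hδ j
  have key : ∀ a : ℝ, 0 < a → (n : ℝ) * xlnx (a / n) = xlnx a - a * Real.log n := by
    intro a ha; unfold xlnx; rw [Real.log_div ha.ne' hn0.ne']; field_simp
  -- the profile side, term by term
  have H : (n : ℝ) * laiProfile J r M δ ((ν : ℝ) / n) =
      (∑ j : Fin J, (n : ℝ) * xlnx ((M : ℝ) - 2 * (δ j : ℝ))) + n * xlnx ((ν : ℝ) / n) -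
        n * xlnx ((ν : ℝ) / n - r) + n * xlnx ((ν : ℝ) / n + M + r) - n * xlnx ((ν : ℝ) / n + M) -
        ∑ j : Fin J, ((n : ℝ) * xlnx ((ν : ℝ) / n + M - δ j) - n * xlnx ((ν : ℝ) / n + δ j)) := by
    unfold laiProfile; simp only [mul_sub, mul_add, mul_sum]
  have t0 : ∀ j : Fin J, (n : ℝ) * xlnx ((M : ℝ) - 2 * (δ j : ℝ)) =
      xlnx (((M : ℝ) - 2 * (δ j : ℝ)) * n) - ((M : ℝ) - 2 * (δ j : ℝ)) * n * Real.log n := by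
    intro j
    have := key (((M : ℝ) - 2 * (δ j : ℝ)) * n) (mul_pos (by linarith [hδ' j]) hn0)
    rw [mul_div_cancel_right₀ _ hn0.ne'] at this; exact this
  have t1 : (n : ℝ) * xlnx ((ν : ℝ) / n) = xlnx (ν : ℝ) - (ν : ℝ) * Real.log n := key _ hν0
  have t2 : (n : ℝ) * xlnx ((ν : ℝ) / n - r) = xlnx ((ν : ℝ) - r * n) - ((ν : ℝ) - r * n) * Real.log n := by
    rw [show (ν : ℝ) / n - r = ((ν : ℝ) - r * n) / n by field_simp]; exact key _ (by linarith)
  have t3 : (n : ℝ) * xlnx ((ν : ℝ) / n + M + r) =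
      xlnx ((ν : ℝ) + M * n + r * n) - ((ν : ℝ) + M * n + r * n) * Real.log n := by
    rw [show (ν : ℝ) / n + M + r = ((ν : ℝ) + M * n + r * n) / n by field_simp]; exact key _ (by positivity)
  have t4 : (n : ℝ) * xlnx ((ν : ℝ) / n + M) = xlnx ((ν : ℝ) + M * n) - ((ν : ℝ) + M * n) * Real.log n := by
    rw [show (ν : ℝ) / n + M = ((ν : ℝ) + M * n) / n by field_simp]; exact key _ (by positivity)
  have t5 : ∀ j : Fin J, (n : ℝ) * xlnx ((ν : ℝ) / n + M - δ j) =
      xlnx ((ν : ℝ) + δ j * n + ((M : ℝ) - 2 * (δ j : ℝ)) * n) -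
        ((ν : ℝ) + δ j * n + ((M : ℝ) - 2 * (δ j : ℝ)) * n) * Real.log n := by
    intro j
    rw [show (ν : ℝ) / n + M - δ j = ((ν : ℝ) + δ j * n + ((M : ℝ) - 2 * (δ j : ℝ)) * n) / n by
      field_simp; ring]
    exact key _ (by nlinarith [hδ' j, Nat.cast_nonneg (α := ℝ) (δ j)])
  have t6 : ∀ j : Fin J, (n : ℝ) * xlnx ((ν : ℝ) / n + δ j) =
      xlnx ((ν : ℝ) + δ j * n) - ((ν : ℝ) + δ j * n) * Real.log n := by
    intro j
    rw [show (ν : ℝ) / n + δ j = ((ν : ℝ) + δ j * n) / n by field_simp]; exact key _ (by positivity)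
  have T0 : ∑ j : Fin J, (n : ℝ) * xlnx ((M : ℝ) - 2 * (δ j : ℝ)) =
      ∑ j : Fin J, (xlnx (((M : ℝ) - 2 * (δ j : ℝ)) * n) - ((M : ℝ) - 2 * (δ j : ℝ)) * n * Real.log n) :=
    sum_congr rfl fun j _ => t0 j
  have T56 : ∑ j : Fin J, ((n : ℝ) * xlnx ((ν : ℝ) / n + M - δ j) - n * xlnx ((ν : ℝ) / n + δ j)) =
      ∑ j : Fin J, ((xlnx ((ν : ℝ) + δ j * n + ((M : ℝ) - 2 * (δ j : ℝ)) * n) -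
        ((ν : ℝ) + δ j * n + ((M : ℝ) - 2 * (δ j : ℝ)) * n) * Real.log n) -
        (xlnx ((ν : ℝ) + δ j * n) - ((ν : ℝ) + δ j * n) * Real.log n)) :=
    sum_congr rfl fun j _ => by rw [t5 j, t6 j]
  rw [H, t1, t2, t3, t4, T0, T56]
  -- collect the `log n` terms of the two sums
  have S1 : ∑ j : Fin J, (xlnx (((M : ℝ) - 2 * (δ j : ℝ)) * n) - ((M : ℝ) - 2 * (δ j : ℝ)) * n * Real.log n) =
      (∑ j : Fin J, xlnx (((M : ℝ) - 2 * (δ j : ℝ)) * n)) -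
        (∑ j : Fin J, ((M : ℝ) - 2 * (δ j : ℝ)) * n) * Real.log n := by
    rw [sum_sub_distrib, sum_mul]
  have S2 : ∑ j : Fin J, ((xlnx ((ν : ℝ) + δ j * n + ((M : ℝ) - 2 * (δ j : ℝ)) * n) -
        ((ν : ℝ) + δ j * n + ((M : ℝ) - 2 * (δ j : ℝ)) * n) * Real.log n) -
        (xlnx ((ν : ℝ) + δ j * n) - ((ν : ℝ) + δ j * n) * Real.log n)) =
      (∑ j : Fin J, xlnx ((ν : ℝ) + δ j * n + ((M : ℝ) - 2 * (δ j : ℝ)) * n)) -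
        (∑ j : Fin J, xlnx ((ν : ℝ) + δ j * n)) - (∑ j : Fin J, ((M : ℝ) - 2 * (δ j : ℝ)) * n) * Real.log n := by
    rw [sum_mul, ← sum_sub_distrib, ← sum_sub_distrib]
    exact sum_congr rfl fun j _ => by ring
  rw [S1, S2]
  -- the laiMain side: casts
  have hc1 : (((ν - r * n : ℕ)) : ℝ) = (ν : ℝ) - r * n := by rw [Nat.cast_sub hν.le]; push_cast; ring
  have hc2 : ∀ j : Fin J, (((M - 2 * δ j : ℕ)) : ℝ) = (M : ℝ) - 2 * (δ j : ℝ) := fun j => by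
    rw [Nat.cast_sub (hδ j).le]; push_cast; ring
  unfold laiMain
  simp only [Nat.cast_add, Nat.cast_mul, hc1, hc2, sum_sub_distrib]
  unfold xlnx
  ring

/-! ### The error bound -/

/-- The explicit uniform-Stirling constant `C = 10 + 6J + 6r`. [this file] -/
def laiStirC (J r : ℕ) : ℝ := 10 + 6 * J + 6 * r

/-- `laiStirC ≥ 0`. [this file] -/
theorem laiStirC_nonneg (J r : ℕ) : 0 ≤ laiStirC J r := by unfold laiStirC; positivity

/-- **UNIFORM STIRLING (DECAY-L1 Lemma 2.1)**: `|log(C_n R_n(ν)) − n f(ν/n)| ≤ laiStirC · log(ν+(M+r)n+2)` for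
`ν > rn`, `n ≥ 1`, `2δ_j < M`. [this file] -/
theorem abs_log_laiTermR_sub_le (hδ : ∀ j, 2 * δ j < M) (hn : 1 ≤ n) (hν : r * n < ν) :
    |Real.log (laiTermR J r M n δ (fun m => laiC J r M m δ) ν) - n * laiProfile J r M δ ((ν : ℝ) / n)| ≤
      laiStirC J r * Real.log ((ν : ℝ) + ((M : ℝ) + r) * n + 2) := by
  rw [log_laiTermR_laiC_eq_main_add hν, laiMain_eq hδ hn hν, add_assoc, add_sub_cancel_left]
  -- linear facts about the arguments
  have hn1 : (1 : ℝ) ≤ n := by exact_mod_cast hn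
  have hrn : (r : ℝ) * n + 1 ≤ ν := by exact_mod_cast hν
  have hMn : (0 : ℝ) ≤ (M : ℝ) * n := by positivity
  have hrn0 : (0 : ℝ) ≤ (r : ℝ) * n := by positivity
  have hδn : ∀ j : Fin J, 0 ≤ (δ j : ℝ) * n ∧ (2 * (δ j : ℝ) + 1) * n ≤ (M : ℝ) * n := fun j =>
    ⟨by positivity, mul_le_mul_of_nonneg_right (by exact_mod_cast hδ j) (by positivity)⟩
  have hc1 : (((ν - r * n : ℕ)) : ℝ) = (ν : ℝ) - r * n := by rw [Nat.cast_sub hν.le]; push_cast; ring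
  have hc2 : ∀ j : Fin J, (((M - 2 * δ j : ℕ)) : ℝ) = (M : ℝ) - 2 * (δ j : ℝ) := fun j => by
    rw [Nat.cast_sub (hδ j).le]; push_cast; ring
  set W : ℝ := (ν : ℝ) + ((M : ℝ) + r) * n + 2 with hW
  have hW2 : 2 ≤ W := by rw [hW]; linarith
  set Λ : ℝ := Real.log W with hΛ
  have hΛ2 : Real.log 2 ≤ Λ := Real.log_le_log two_pos hW2
  have hl2 : (1 : ℝ) / 2 ≤ Real.log 2 := by have := Real.log_two_gt_d9; linarith
  have hΛ0 : 0 ≤ Λ := by linarith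
  -- generic bounds: `0 ≤ log x ≤ Λ` on `[1, W]`, `0 ≤ E(m) ≤ 3Λ` for `1 ≤ m ≤ W`
  have hL : ∀ x : ℝ, 1 ≤ x → x ≤ W → 0 ≤ Real.log x ∧ Real.log x ≤ Λ := fun x h1 h2 =>
    ⟨Real.log_nonneg h1, Real.log_le_log (by linarith) h2⟩
  have hE : ∀ m : ℕ, 1 ≤ m → (m : ℝ) ≤ W → 0 ≤ logFactErr m ∧ logFactErr m ≤ 3 * Λ := by
    intro m h1 h2
    have hb := logFactErr_bounds (m := m) (by omega)
    have := (hL m (by exact_mod_cast h1) h2).2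
    exact ⟨hb.1, by linarith [hb.2]⟩
  -- the explicit logarithms
  have a1 : 0 ≤ Real.log (2 * (ν : ℝ) + (M : ℝ) * n) := Real.log_nonneg (by linarith)
  have a1' : Real.log (2 * (ν : ℝ) + (M : ℝ) * n) ≤ 2 * Λ := by
    have h := Real.log_le_log (by linarith) (show 2 * (ν : ℝ) + (M : ℝ) * n ≤ 2 * W by rw [hW]; linarith)
    rw [Real.log_mul two_ne_zero (by linarith)] at h
    linarith
  have a2 := hL (ν : ℝ) (by linarith) (by rw [hW]; linarith)
  have a3 := hL (((ν - r * n : ℕ)) : ℝ) (by rw [hc1]; linarith) (by rw [hc1, hW]; linarith)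
  have a4 : ∀ j : Fin J, 0 ≤ Real.log (((ν + δ j * n : ℕ)) : ℝ) ∧ Real.log (((ν + δ j * n : ℕ)) : ℝ) ≤ Λ :=
    fun j => hL _ (by push_cast; linarith [(hδn j).1]) (by push_cast; rw [hW]; linarith [(hδn j).1, (hδn j).2])
  have s4 : 0 ≤ ∑ j : Fin J, Real.log (((ν + δ j * n : ℕ)) : ℝ) := sum_nonneg fun j _ => (a4 j).1
  have s4' : ∑ j : Fin J, Real.log (((ν + δ j * n : ℕ)) : ℝ) ≤ J * Λ := by
    have := sum_le_sum fun j (_ : j ∈ (univ : Finset (Fin J))) => (a4 j).2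
    rwa [sum_const, card_univ, Fintype.card_fin, nsmul_eq_mul] at this
  -- the Stirling errors
  have b1 := hE ν (by omega) (by rw [hW]; linarith)
  have b2 := hE (ν - r * n) (by omega) (by rw [hc1, hW]; linarith)
  have b3 := hE (ν + M * n + r * n) (by omega) (by push_cast; rw [hW]; linarith)
  have b4 := hE (ν + M * n) (by omega) (by push_cast; rw [hW]; linarith)
  have b5 : ∀ j : Fin J, 0 ≤ logFactErr (ν + δ j * n + (M - 2 * δ j) * n) ∧
      logFactErr (ν + δ j * n + (M - 2 * δ j) * n) ≤ 3 * Λ := fun j =>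
    hE _ (by omega) (by push_cast [hc2 j]; rw [hW]; linarith [(hδn j).1])
  have b6 : ∀ j : Fin J, 0 ≤ logFactErr (ν + δ j * n) ∧ logFactErr (ν + δ j * n) ≤ 3 * Λ := fun j =>
    hE _ (by omega) (by push_cast; rw [hW]; linarith [(hδn j).1, (hδn j).2])
  have b7 : ∀ j : Fin J, 0 ≤ logFactErr ((M - 2 * δ j) * n) ∧ logFactErr ((M - 2 * δ j) * n) ≤ 3 * Λ :=
    fun j => hE _ (Nat.one_le_iff_ne_zero.mpr (Nat.mul_ne_zero (by have := hδ j; omega) (by omega)))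
      (by push_cast [hc2 j]; rw [hW]; linarith [(hδn j).1])
  have b8 : 0 ≤ 2 * (r : ℝ) * logFactErr n ∧ 2 * (r : ℝ) * logFactErr n ≤ 2 * r * (3 * Λ) := by
    have h0 := (logFactErr_bounds (m := n) (by omega)).1
    refine ⟨by positivity, ?_⟩
    rcases Nat.eq_zero_or_pos r with hr | hr
    · subst hr; simp
    · have hr1 : (1 : ℝ) ≤ r := by exact_mod_cast hr
      have hnW : (n : ℝ) ≤ W := by
        rw [hW]; nlinarith
      exact mul_le_mul_of_nonneg_left (hE n hn hnW).2 (by positivity)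
  have s5 : -(J * (3 * Λ)) ≤ ∑ j : Fin J, (logFactErr (ν + δ j * n + (M - 2 * δ j) * n) - logFactErr (ν + δ j * n))
      ∧ ∑ j : Fin J, (logFactErr (ν + δ j * n + (M - 2 * δ j) * n) - logFactErr (ν + δ j * n)) ≤ J * (3 * Λ) := by
    constructor
    · have := sum_le_sum fun j (_ : j ∈ (univ : Finset (Fin J))) =>
        (show -(3 * Λ) ≤ logFactErr (ν + δ j * n + (M - 2 * δ j) * n) - logFactErr (ν + δ j * n) by
          linarith [(b5 j).1, (b6 j).2])
      rw [sum_const, card_univ, Fintype.card_fin, nsmul_eq_mul] at this; linarith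
    · have := sum_le_sum fun j (_ : j ∈ (univ : Finset (Fin J))) =>
        (show logFactErr (ν + δ j * n + (M - 2 * δ j) * n) - logFactErr (ν + δ j * n) ≤ 3 * Λ by
          linarith [(b5 j).2, (b6 j).1])
      rw [sum_const, card_univ, Fintype.card_fin, nsmul_eq_mul] at this; linarith
  have s7 : 0 ≤ ∑ j : Fin J, logFactErr ((M - 2 * δ j) * n) ∧
      ∑ j : Fin J, logFactErr ((M - 2 * δ j) * n) ≤ J * (3 * Λ) := by
    refine ⟨sum_nonneg fun j _ => (b7 j).1, ?_⟩
    have := sum_le_sum fun j (_ : j ∈ (univ : Finset (Fin J))) => (b7 j).2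
    rwa [sum_const, card_univ, Fintype.card_fin, nsmul_eq_mul] at this
  -- assemble
  have hJ0 : (0 : ℝ) ≤ J := Nat.cast_nonneg _
  have hr0 : (0 : ℝ) ≤ r := Nat.cast_nonneg _
  have hJΛ : 0 ≤ (J : ℝ) * Λ := mul_nonneg hJ0 hΛ0
  have hrΛ : 0 ≤ (r : ℝ) * Λ := mul_nonneg hr0 hΛ0
  have hlo : -((7 + 4 * J + 6 * r) * Λ) ≤ laiErrLog J r M n δ ν + laiErrStirling J r M n δ ν := by
    unfold laiErrLog laiErrStirling
    linarith [a2.2, a3.1, b1.1, b2.2, b3.1, b4.2, s5.2, s7.1, b8.2]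
  have hhi : laiErrLog J r M n δ ν + laiErrStirling J r M n δ ν ≤ (9 + 6 * J) * Λ := by
    unfold laiErrLog laiErrStirling
    linarith [a2.1, a3.2, b1.2, b2.1, b3.2, b4.1, s5.1, s7.2, b8.1]
  unfold laiStirC
  rw [abs_le]
  constructor <;> linarith

/-! ### The `upper` / `lower` / `summable` fields of `LaiDecayInputs … laiC` -/

/-- **FIELD `upper`** of `LaiDecayInputs J r M δ (laiC J r M · δ)` with `C := laiStirC J r` (for `2δ_j < M`). [this file] -/
theorem laiTermR_laiC_upper (hδ : ∀ j, 2 * δ j < M) :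
    ∀ n ν : ℕ, 1 ≤ n → r * n < ν →
      laiTermR J r M n δ (fun m => laiC J r M m δ) ν ≤
        Real.exp (n * laiProfile J r M δ ((ν : ℝ) / n) +
          laiStirC J r * Real.log ((ν : ℝ) + ((M : ℝ) + r) * n + 2)) := by
  intro n ν hn hν
  have hpos := laiTermR_laiC_pos J r M n δ hν
  have h := (abs_le.1 (abs_log_laiTermR_sub_le (J := J) (δ := δ) hδ hn hν)).2
  calc laiTermR J r M n δ (fun m => laiC J r M m δ) ν
      = Real.exp (Real.log (laiTermR J r M n δ (fun m => laiC J r M m δ) ν)) := (Real.exp_log hpos).symm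
    _ ≤ _ := Real.exp_le_exp.2 (by linarith)

/-- **FIELD `lower`** of `LaiDecayInputs J r M δ (laiC J r M · δ)` with `C := laiStirC J r` (for `2δ_j < M`). [this file] -/
theorem laiTermR_laiC_lower (hδ : ∀ j, 2 * δ j < M) :
    ∀ n ν : ℕ, 1 ≤ n → r * n < ν →
      Real.exp (n * laiProfile J r M δ ((ν : ℝ) / n) -
          laiStirC J r * Real.log ((ν : ℝ) + ((M : ℝ) + r) * n + 2)) ≤
        laiTermR J r M n δ (fun m => laiC J r M m δ) ν := by
  intro n ν hn hν
  have hpos := laiTermR_laiC_pos J r M n δ hν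
  have h := (abs_le.1 (abs_log_laiTermR_sub_le (J := J) (δ := δ) hδ hn hν)).1
  calc Real.exp (n * laiProfile J r M δ ((ν : ℝ) / n) - laiStirC J r * Real.log ((ν : ℝ) + ((M : ℝ) + r) * n + 2))
      ≤ Real.exp (Real.log (laiTermR J r M n δ (fun m => laiC J r M m δ) ν)) := Real.exp_le_exp.2 (by linarith)
    _ = _ := Real.exp_log hpos

/-- **FIELD `summable`** of `LaiDecayInputs J r M δ (laiC J r M · δ)`, from the tree's `laiBox_hasSum_oddZeta`
(Ball–Rivoal decomposition ⇒ convergence) under its hypotheses. [this file] -/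
theorem laiTermR_laiC_summable (hJ : Even J) (hJ1 : 1 ≤ J) (hδ : ∀ j, 2 * δ j ≤ M)
    (hdeg : ∀ n : ℕ, 1 + 2 * (r * n) + (∑ j, 2 * (δ j * n)) + 2 ≤ J * (M * n + 1)) :
    ∀ n : ℕ, Summable fun k : ℕ => laiTermR J r M n δ (fun m => laiC J r M m δ) (k + 1) := by
  intro n
  obtain ⟨a, ha⟩ := laiBox_hasSum_oddZeta J r M n δ hJ hJ1 hδ (hdeg n)
  have hs := (ha.summable.mul_left (((laiC J r M n δ : ℚ) : ℝ)))
  refine hs.congr fun k => ?_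
  simp [laiTermR, Nat.cast_succ]

end

end Summit.KontsevichZagierPeriods.Zeta5Search
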